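import Mathlib.Analysis.SpecialFunctions.PolarCoord
import Mathlib.Analysis.SpecialFunctions.Complex.Circle
import Mathlib.Analysis.Fourier.AddCircle
import Mathlib.MeasureTheory.Measure.Haar.InnerProductSpace
import Mathlib.Analysis.InnerProductSpace.PiL2
import Mathlib.MeasureTheory.Integral.Prod
import Literature.Analysis.FluidPDE.GaussianVortexPlanar
import HarnessLib

/-!
# Polar coordinates and angular Fourier coefficients on `EuclideanSpace ℝ (Fin 2)`

Support file (everything proved, `[folklore]`) for the angular Fourier analysis of planar
functions used in the proof of Maekawa's kernel lemma
(`Literature.Analysis.FluidPDE.GallayMaekawa2016_lem27_classical`, Gallay–Maekawa 2016,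
Lemma 2.7). On `ℝ² = EuclideanSpace ℝ (Fin 2)`:

* `circlePt r θ = (r cos θ, r sin θ)`, its norm, continuity, angular velocity
  `∂_θ circlePt r θ = (circlePt r θ)^⊥` (`perp` of `GaussianVortexPlanar`), and the polar
  representation `ξ = circlePt ‖ξ‖ (arg(ξ₀ + iξ₁))`;
* the complexification `cplx ξ = ξ₀ + iξ₁` with `‖cplx ξ‖ = ‖ξ‖`,
  `cplx (circlePt r θ) = r e^{iθ}`, `⟪η^⊥, ξ⟫ = Im (cplx ξ · conj (cplx η))`;
* **polar coordinates**: for an integrable `g : ℝ² → E`,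
  `∫ g = ∫_{ρ>0} ρ • ∫_{θ ∈ (-π, π]} g(circlePt ρ θ) dθ dρ` (Mathlib's `integral_comp_polarCoord_symm`
  transported along the volume-preserving identification `ℝ² ≃ ℝ × ℝ`), with the integrability
  of the radial marginal;
* the **angular Fourier coefficients** on the circle of radius `r`,
  `angCoeff g r n = (2π)⁻¹ ∫_{-π}^{π} e^{-inθ} g(circlePt r θ) dθ`: conjugation symmetry for real
  `g`, the bound by the circle mean of `‖g‖`, continuity in `r`, the coefficient of an angular
  derivative (`i n` times the coefficient: integration by parts on a full turn), orthogonality of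
  `e^{imθ}`, and **Fourier synthesis** for a function whose coefficients vanish for `|n| ≥ 2`
  (Mathlib's `has_pointwise_sum_fourier_series_of_summable` on `AddCircle (2π)`).

## References

* Th. Gallay, Y. Maekawa, *Existence and stability of viscous vortices*, arXiv:1610.08384, §2.2,
  Lemma 2.7. [GallayMaekawa2016]
-/

noncomputable section

open Set Function Filter MeasureTheory WithLp Complex
open scoped Real Topology InnerProductSpace RealInnerProductSpace ComplexConjugate

namespace Literature.Analysis.FluidPDE

/-- Local notation for the plane `ℝ² = EuclideanSpace ℝ (Fin 2)`. -/
local notation "ℝ²" => EuclideanSpace ℝ (Fin 2)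

/-! ### Circle points -/

/-- The circle point `circlePt r θ = (r cos θ, r sin θ) ∈ ℝ²`. [folklore] -/
def circlePt (r θ : ℝ) : ℝ² :=
  toLp 2 ![r * Real.cos θ, r * Real.sin θ]

/-- First coordinate of a circle point. [folklore] -/
@[simp] theorem circlePt_apply_zero (r θ : ℝ) : circlePt r θ 0 = r * Real.cos θ := rfl

/-- Second coordinate of a circle point. [folklore] -/
@[simp] theorem circlePt_apply_one (r θ : ℝ) : circlePt r θ 1 = r * Real.sin θ := rfl

/-- `|(r cos θ, r sin θ)| = |r|`. [folklore] -/
theorem norm_circlePt (r θ : ℝ) : ‖circlePt r θ‖ = |r| := by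
  rw [EuclideanSpace.norm_eq, ← Real.sqrt_sq_eq_abs]
  congr 1
  simp only [Fin.sum_univ_two, circlePt_apply_zero, circlePt_apply_one, Real.norm_eq_abs, sq_abs]
  linear_combination r ^ 2 * (Real.cos_sq_add_sin_sq θ)

/-- The circle of radius `0` is the origin. [folklore] -/
@[simp] theorem circlePt_zero_left (θ : ℝ) : circlePt 0 θ = 0 := by
  ext i; fin_cases i <;> simp [circlePt]

/-- The circle point in the standard basis. [folklore] -/
theorem circlePt_eq_smul_single (r θ : ℝ) :
    circlePt r θ = (r * Real.cos θ) • EuclideanSpace.single 0 (1 : ℝ) +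
      (r * Real.sin θ) • EuclideanSpace.single 1 (1 : ℝ) := by
  ext i; fin_cases i <;> simp [circlePt]

/-- `(r cos θ, r sin θ)^⊥` in the standard basis. [folklore] -/
theorem perp_circlePt_eq_smul_single (r θ : ℝ) :
    perp (circlePt r θ) = (-(r * Real.sin θ)) • EuclideanSpace.single 0 (1 : ℝ) +
      (r * Real.cos θ) • EuclideanSpace.single 1 (1 : ℝ) := by
  ext i; fin_cases i <;> simp [circlePt, perp]

/-- `(r, θ) ↦ circlePt r θ` is continuous. [folklore] -/
theorem continuous_circlePt_uncurry : Continuous fun p : ℝ × ℝ => circlePt p.1 p.2 := by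
  refine (PiLp.continuous_toLp 2 _).comp (continuous_pi fun i => ?_)
  fin_cases i
  · exact continuous_fst.mul (Real.continuous_cos.comp continuous_snd)
  · exact continuous_fst.mul (Real.continuous_sin.comp continuous_snd)

/-- `θ ↦ circlePt r θ` is continuous. [folklore] -/
theorem continuous_circlePt (r : ℝ) : Continuous fun θ : ℝ => circlePt r θ :=
  continuous_circlePt_uncurry.comp (continuous_const.prodMk continuous_id)

/-- `r ↦ circlePt r θ` is continuous. [folklore] -/
theorem continuous_circlePt_left (θ : ℝ) : Continuous fun r : ℝ => circlePt r θ :=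
  continuous_circlePt_uncurry.comp (continuous_id.prodMk continuous_const)

/-- The circle `θ ↦ (r cos θ, r sin θ)` has velocity `(circlePt r θ)^⊥`. [folklore] -/
theorem hasDerivAt_circlePt (r θ : ℝ) :
    HasDerivAt (fun θ : ℝ => circlePt r θ) (perp (circlePt r θ)) θ := by
  rw [perp_circlePt_eq_smul_single]
  have h := (((Real.hasDerivAt_cos θ).const_mul r).smul_const
      (EuclideanSpace.single (0 : Fin 2) (1 : ℝ))).add
    (((Real.hasDerivAt_sin θ).const_mul r).smul_const (EuclideanSpace.single (1 : Fin 2) (1 : ℝ)))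
  simp only [mul_neg] at h
  refine h.congr_of_eventuallyEq (Eventually.of_forall fun t => ?_)
  exact circlePt_eq_smul_single r t

/-- `θ ↦ (circlePt r θ)^⊥ = (-r sin θ, r cos θ)` is continuous. [folklore] -/
theorem continuous_perp_circlePt (r : ℝ) : Continuous fun θ : ℝ => perp (circlePt r θ) := by
  have h : (fun θ : ℝ => perp (circlePt r θ)) = fun θ => toLp 2 ![-(r * Real.sin θ), r * Real.cos θ] := by
    funext θ; ext i; fin_cases i <;> simp [circlePt, perp]
  rw [h]
  refine (PiLp.continuous_toLp 2 _).comp (continuous_pi fun i => ?_)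
  fin_cases i
  · exact (continuous_const.mul Real.continuous_sin).neg
  · exact continuous_const.mul Real.continuous_cos

/-- `θ ↦ circlePt r θ` is `2π`-periodic. [folklore] -/
theorem periodic_circlePt (r : ℝ) : Periodic (fun θ : ℝ => circlePt r θ) (2 * π) :=
  fun θ => by simp [circlePt, Real.cos_add_two_pi, Real.sin_add_two_pi]

/-- Half a turn is the antipode: `circlePt r (θ + π) = circlePt (-r) θ`. [folklore] -/
theorem circlePt_add_pi (r θ : ℝ) : circlePt r (θ + π) = circlePt (-r) θ := by
  ext i; fin_cases i <;> simp [circlePt, Real.cos_add_pi, Real.sin_add_pi]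

/-! ### Complexification -/

/-- The complexification `cplx ξ = ξ₀ + i ξ₁` of a point of `ℝ²`. [folklore] -/
def cplx (ξ : ℝ²) : ℂ := ⟨ξ 0, ξ 1⟩

/-- Real part of the complexification. [folklore] -/
@[simp] theorem cplx_re (ξ : ℝ²) : (cplx ξ).re = ξ 0 := rfl

/-- Imaginary part of the complexification. [folklore] -/
@[simp] theorem cplx_im (ξ : ℝ²) : (cplx ξ).im = ξ 1 := rfl

/-- `‖ξ₀ + iξ₁‖ = ‖ξ‖`. [folklore] -/
theorem norm_cplx (ξ : ℝ²) : ‖cplx ξ‖ = ‖ξ‖ := by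
  rw [Complex.norm_eq_sqrt_sq_add_sq, EuclideanSpace.norm_eq]
  simp [Fin.sum_univ_two]

/-- `cplx` is additive. [folklore] -/
theorem cplx_sub (ξ η : ℝ²) : cplx (ξ - η) = cplx ξ - cplx η := by
  apply Complex.ext <;> simp

/-- The complexification of a circle point: `cplx (circlePt r θ) = r e^{iθ}`. [folklore] -/
theorem cplx_circlePt (r θ : ℝ) : cplx (circlePt r θ) = r * Complex.exp (θ * I) := by
  apply Complex.ext
  · simp [Complex.exp_ofReal_mul_I_re]
  · simp [Complex.exp_ofReal_mul_I_im]

/-- `⟪η^⊥, ξ⟫ = Im (cplx ξ · conj (cplx η))` (the planar cross product). [folklore] -/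
theorem inner_perp_left_eq_im (η ξ : ℝ²) : ⟪perp η, ξ⟫ = (cplx ξ * conj (cplx η)).im := by
  simp only [PiLp.inner_apply, Fin.sum_univ_two, perp_apply_zero, perp_apply_one,
    RCLike.inner_apply, conj_trivial, Complex.mul_im, cplx_re, cplx_im, Complex.conj_re,
    Complex.conj_im]

/-- `cplx` is continuous. [folklore] -/
theorem continuous_cplx : Continuous cplx := by
  have h : cplx = fun ξ : ℝ² => Complex.equivRealProdCLM.symm (ξ 0, ξ 1) := by
    funext ξ
    apply Complex.ext <;> simp [cplx]
  rw [h]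
  exact Complex.equivRealProdCLM.symm.continuous.comp
    ((PiLp.continuous_apply 2 _ 0).prodMk (PiLp.continuous_apply 2 _ 1))

/-- Polar angle: every `ξ` is the circle point of radius `‖ξ‖` at the angle `arg (cplx ξ)`.
[folklore] -/
theorem circlePt_norm_arg (ξ : ℝ²) : circlePt ‖ξ‖ (Complex.arg (cplx ξ)) = ξ := by
  have h0 := Complex.norm_mul_cos_arg (cplx ξ)
  have h1 := Complex.norm_mul_sin_arg (cplx ξ)
  rw [norm_cplx] at h0 h1
  ext i; fin_cases i
  · simpa using h0
  · simpa using h1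

/-! ### Polar coordinates on `ℝ²` -/

/-- **Polar coordinates on `EuclideanSpace ℝ (Fin 2)`, integrability.** For an integrable `g`,
`(ρ, θ) ↦ ρ • g(circlePt ρ θ)` is integrable on `(0, ∞) × (-π, π]` (product of the restricted
Lebesgue measures). Transport of Mathlib's polar-coordinate change of variables along the
volume-preserving identification `ℝ² ≃ ℝ × ℝ`. [folklore] -/
theorem integrable_circlePt_smul {E : Type*} [NormedAddCommGroup E] [NormedSpace ℝ E]
    {g : ℝ² → E} (hg : Integrable g) :
    Integrable (fun p : ℝ × ℝ => p.1 • g (circlePt p.1 p.2))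
      ((volume.restrict (Ioi (0 : ℝ))).prod (volume.restrict (Ioc (-π) π))) := by
  set T : ℝ² ≃ᵐ ℝ × ℝ :=
    (MeasurableEquiv.toLp 2 (Fin 2 → ℝ)).symm.trans MeasurableEquiv.finTwoArrow with hT
  have hTmp : MeasurePreserving T volume volume :=
    (EuclideanSpace.volume_preserving_symm_measurableEquiv_toLp (Fin 2)).trans
      (volume_preserving_finTwoArrow ℝ)
  have hTsymm : ∀ p : ℝ × ℝ, T.symm (polarCoord.symm p) = circlePt p.1 p.2 := fun p => by
    ext i; fin_cases i <;> rfl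
  set g' : ℝ × ℝ → E := g ∘ T.symm with hg'
  have h1 : Integrable g' := (hTmp.symm _).integrable_comp_emb T.symm.measurableEmbedding |>.2 hg
  have h2 : IntegrableOn g' (polarCoord.symm '' polarCoord.target) := h1.integrableOn
  rw [integrableOn_image_iff_integrableOn_abs_det_fderiv_smul volume polarCoord.open_target.measurableSet
    (fun p _ ↦ (hasFDerivAt_polarCoord_symm p).hasFDerivWithinAt) polarCoord.symm.injOn] at h2
  have h3 : IntegrableOn (fun p : ℝ × ℝ => p.1 • g (circlePt p.1 p.2)) polarCoord.target := by
    refine h2.congr_fun (fun p hp ↦ ?_) polarCoord.open_target.measurableSet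
    have hp1 : 0 < p.1 := hp.1
    simp only [det_fderivPolarCoordSymm, hg', Function.comp_apply, hTsymm, abs_of_pos hp1]
  rw [polarCoord_target, IntegrableOn, Measure.volume_eq_prod, ← Measure.prod_restrict] at h3
  -- replace `Ioo (-π) π` by `Ioc (-π) π`
  rwa [Measure.restrict_congr_set (Ioo_ae_eq_Ioc (α := ℝ))] at h3

/-- **Polar coordinates on `EuclideanSpace ℝ (Fin 2)`.** For an integrable `g : ℝ² → E`,
`∫ g = ∫_{ρ ∈ (0,∞)} ∫_{θ ∈ (-π,π]} ρ • g(ρ cos θ, ρ sin θ) dθ dρ`. [folklore] -/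
theorem integral_eq_integral_circlePt {E : Type*} [NormedAddCommGroup E] [NormedSpace ℝ E]
    {g : ℝ² → E} (hg : Integrable g) :
    ∫ ξ, g ξ = ∫ ρ in Ioi (0 : ℝ), ∫ θ in Ioc (-π) π, ρ • g (circlePt ρ θ) := by
  set T : ℝ² ≃ᵐ ℝ × ℝ :=
    (MeasurableEquiv.toLp 2 (Fin 2 → ℝ)).symm.trans MeasurableEquiv.finTwoArrow with hT
  have hTmp : MeasurePreserving T volume volume :=
    (EuclideanSpace.volume_preserving_symm_measurableEquiv_toLp (Fin 2)).trans
      (volume_preserving_finTwoArrow ℝ)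
  have hTsymm : ∀ p : ℝ × ℝ, T.symm (polarCoord.symm p) = circlePt p.1 p.2 := fun p => by
    ext i; fin_cases i <;> rfl
  have hint := integrable_circlePt_smul hg
  calc ∫ ξ, g ξ = ∫ p : ℝ × ℝ, g (T.symm p) := (hTmp.symm.integral_comp' (f := T.symm) g).symm
    _ = ∫ p in polarCoord.target, p.1 • g (T.symm (polarCoord.symm p)) :=
        (integral_comp_polarCoord_symm _).symm
    _ = ∫ p in Ioi (0 : ℝ) ×ˢ Ioc (-π) π, p.1 • g (circlePt p.1 p.2) := by
        simp_rw [hTsymm, polarCoord_target]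
        rw [Measure.volume_eq_prod]
        exact setIntegral_congr_set (Measure.set_prod_ae_eq (ae_eq_refl _) Ioo_ae_eq_Ioc)
    _ = ∫ ρ in Ioi (0 : ℝ), ∫ θ in Ioc (-π) π, ρ • g (circlePt ρ θ) := by
        rw [Measure.volume_eq_prod, setIntegral_prod]
        rwa [IntegrableOn, ← Measure.prod_restrict]

/-- The radial marginal of an integrable planar function is integrable:
`ρ ↦ ∫_{(-π,π]} ‖ρ • g(circlePt ρ θ)‖ dθ ∈ L¹((0, ∞))`. [folklore] -/
theorem integrableOn_integral_norm_circlePt_smul {E : Type*} [NormedAddCommGroup E]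
    [NormedSpace ℝ E] {g : ℝ² → E} (hg : Integrable g) :
    IntegrableOn (fun ρ : ℝ => ∫ θ in Ioc (-π) π, ‖ρ • g (circlePt ρ θ)‖) (Ioi 0) :=
  (integrable_circlePt_smul hg).integral_norm_prod_left

/-! ### Angular Fourier coefficients on circles -/

/-- The character `e_n(θ) = e^{inθ}` as a function of a real angle. [folklore] -/
def angExp (n : ℤ) (θ : ℝ) : ℂ := Complex.exp (n * θ * I)

/-- `e_n(θ) = e^{inθ}`. [folklore] -/
theorem angExp_apply (n : ℤ) (θ : ℝ) : angExp n θ = Complex.exp (n * θ * I) := rfl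

/-- `|e^{inθ}| = 1`. [folklore] -/
@[simp] theorem norm_angExp (n : ℤ) (θ : ℝ) : ‖angExp n θ‖ = 1 := by
  rw [angExp, show (n : ℂ) * θ * I = ((n * θ : ℝ) : ℂ) * I by push_cast; ring,
    Complex.norm_exp_ofReal_mul_I]

/-- `e_0 = 1`. [folklore] -/
@[simp] theorem angExp_zero (θ : ℝ) : angExp 0 θ = 1 := by simp [angExp]

/-- `e_{m}e_{n} = e_{m+n}`. [folklore] -/
theorem angExp_add (m n : ℤ) (θ : ℝ) : angExp (m + n) θ = angExp m θ * angExp n θ := by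
  rw [angExp, angExp, angExp, ← Complex.exp_add]; push_cast; ring_nf

/-- `e_{-n} = conj e_n`. [folklore] -/
theorem angExp_neg (n : ℤ) (θ : ℝ) : angExp (-n) θ = conj (angExp n θ) := by
  rw [angExp, angExp, ← Complex.exp_conj]
  congr 1
  simp [Complex.conj_ofReal]

/-- `e_k = e_1^k` for `k ∈ ℕ`. [folklore] -/
theorem angExp_one_pow (k : ℕ) (θ : ℝ) : angExp 1 θ ^ k = angExp k θ := by
  induction k with
  | zero => simp
  | succ k ih => rw [pow_succ, ih, show ((k + 1 : ℕ) : ℤ) = (k : ℤ) + 1 by push_cast; ring,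
      angExp_add]

/-- Real part of `e_n(θ)`. [folklore] -/
theorem angExp_re (n : ℤ) (θ : ℝ) : (angExp n θ).re = Real.cos (n * θ) := by
  rw [angExp, show (n : ℂ) * θ * I = ((n * θ : ℝ) : ℂ) * I by push_cast; ring,
    Complex.exp_ofReal_mul_I_re]

/-- Imaginary part of `e_n(θ)`. [folklore] -/
theorem angExp_im (n : ℤ) (θ : ℝ) : (angExp n θ).im = Real.sin (n * θ) := by
  rw [angExp, show (n : ℂ) * θ * I = ((n * θ : ℝ) : ℂ) * I by push_cast; ring,
    Complex.exp_ofReal_mul_I_im]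

/-- `cplx (circlePt r θ) = r e_1(θ)`. [folklore] -/
theorem cplx_circlePt_eq_angExp (r θ : ℝ) : cplx (circlePt r θ) = r * angExp 1 θ := by
  rw [cplx_circlePt, angExp]; push_cast; ring_nf

/-- `e_n` is `2π`-periodic. [folklore] -/
theorem angExp_add_two_pi (n : ℤ) (θ : ℝ) : angExp n (θ + 2 * π) = angExp n θ := by
  rw [angExp, angExp, show (n : ℂ) * ((θ + 2 * π : ℝ) : ℂ) * I = n * θ * I + n * (2 * π * I) by
    push_cast; ring, Complex.exp_add, Complex.exp_int_mul_two_pi_mul_I, mul_one]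

/-- `e_n(π) = e_n(-π)`. [folklore] -/
theorem angExp_pi_eq_neg_pi (n : ℤ) : angExp n π = angExp n (-π) := by
  rw [← angExp_add_two_pi n (-π)]; congr 1; ring

/-- `e_n` is continuous. [folklore] -/
theorem continuous_angExp (n : ℤ) : Continuous (angExp n) := by
  unfold angExp; fun_prop

/-- `d/dθ e^{inθ} = in e^{inθ}`. [folklore] -/
theorem hasDerivAt_angExp (n : ℤ) (θ : ℝ) : HasDerivAt (angExp n) (n * I * angExp n θ) θ := by
  unfold angExp
  have h : HasDerivAt (fun x : ℂ => Complex.exp (n * x * I)) (Complex.exp (n * θ * I) * (n * I)) θ := by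
    have h1 : HasDerivAt (fun x : ℂ => n * x * I) (n * I) θ := by
      simpa using ((hasDerivAt_id (θ : ℂ)).const_mul (n : ℂ)).mul_const I
    exact (Complex.hasDerivAt_exp _).comp (θ : ℂ) h1
  simpa [mul_comm] using h.comp_ofReal

/-- **Orthogonality of the characters on a full turn**:
`(2π)⁻¹ ∫_{-π}^{π} e^{-inθ} e^{imθ} dθ = δ_{mn}`. [folklore] -/
theorem integral_angExp_neg_mul_angExp (m n : ℤ) :
    (2 * π : ℂ)⁻¹ * ∫ θ in (-π)..π, angExp (-n) θ * angExp m θ = if m = n then 1 else 0 := by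
  have hπ : (2 * π : ℂ) ≠ 0 := by exact_mod_cast Real.two_pi_pos.ne'
  simp_rw [← angExp_add]
  split_ifs with h
  · subst h
    simp only [neg_add_cancel, angExp_zero, intervalIntegral.integral_const, Complex.real_smul,
      mul_one]
    push_cast
    field_simp
    ring
  · have hc : ((-n + m : ℤ) : ℂ) * I ≠ 0 := by
      refine mul_ne_zero ?_ Complex.I_ne_zero
      exact_mod_cast (show (-n + m : ℤ) ≠ 0 by omega)
    have hI := integral_exp_mul_complex (a := -π) (b := π) hc
    have hfun : (fun θ : ℝ => Complex.exp (((-n + m : ℤ) : ℂ) * I * θ)) = angExp (-n + m) := by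
      funext θ; rw [angExp]; push_cast; ring_nf
    rw [hfun] at hI
    have hper : Complex.exp (((-n + m : ℤ) : ℂ) * I * (π : ℝ)) =
        Complex.exp (((-n + m : ℤ) : ℂ) * I * (-π : ℝ)) := by
      have := angExp_pi_eq_neg_pi (-n + m)
      rw [angExp, angExp] at this
      convert this using 2 <;> push_cast <;> ring
    rw [hI, hper, sub_self, zero_div, mul_zero]

/-- The **angular Fourier coefficient** of a planar function `g` on the circle of radius `r`:
`angCoeff g r n = (2π)⁻¹ ∫_{-π}^{π} e^{-inθ} g(r cos θ, r sin θ) dθ`. [folklore] -/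
def angCoeff (g : ℝ² → ℂ) (r : ℝ) (n : ℤ) : ℂ :=
  (2 * π : ℂ)⁻¹ * ∫ θ in (-π)..π, angExp (-n) θ * g (circlePt r θ)

/-- Unfolding `angCoeff`. [folklore] -/
theorem angCoeff_def (g : ℝ² → ℂ) (r : ℝ) (n : ℤ) :
    angCoeff g r n = (2 * π : ℂ)⁻¹ * ∫ θ in (-π)..π, angExp (-n) θ * g (circlePt r θ) := rfl

/-- **Reality**: for a real-valued `w`, `ŵ_{-n} = conj ŵ_n`. [folklore] -/
theorem angCoeff_neg_ofReal (w : ℝ² → ℝ) (r : ℝ) (n : ℤ) :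
    angCoeff (fun ξ => (w ξ : ℂ)) r (-n) = conj (angCoeff (fun ξ => (w ξ : ℂ)) r n) := by
  rw [angCoeff, angCoeff, map_mul, intervalIntegral.integral_of_le (by linarith [Real.pi_pos]),
    intervalIntegral.integral_of_le (by linarith [Real.pi_pos]), ← integral_conj]
  congr 1
  · rw [map_inv₀, map_mul, Complex.conj_ofReal, map_ofNat]
  · refine integral_congr_ae (Eventually.of_forall fun θ => ?_)
    simp only [map_mul, Complex.conj_ofReal, neg_neg, angExp_neg, RingHomCompTriple.comp_apply,
      RingHom.id_apply]

/-- **The coefficients are bounded by the circle mean of `‖g‖`**: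
`‖ŵ_n(r)‖ ≤ (2π)⁻¹ ∫_{-π}^{π} ‖g(circlePt r θ)‖ dθ`. [folklore] -/
theorem norm_angCoeff_le (g : ℝ² → ℂ) (r : ℝ) (n : ℤ) :
    ‖angCoeff g r n‖ ≤ (2 * π)⁻¹ * ∫ θ in (-π)..π, ‖g (circlePt r θ)‖ := by
  rw [angCoeff, norm_mul, norm_inv, show ‖(2 * π : ℂ)‖ = 2 * π by
    rw [show (2 * π : ℂ) = ((2 * π : ℝ) : ℂ) by push_cast; ring, Complex.norm_real,
      Real.norm_of_nonneg Real.two_pi_pos.le]]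
  gcongr
  refine (intervalIntegral.norm_integral_le_integral_norm (by linarith [Real.pi_pos])).trans_eq ?_
  refine intervalIntegral.integral_congr fun θ _ => ?_
  simp only [norm_mul, norm_angExp, one_mul]

/-- The coefficients depend continuously on the radius (for continuous `g`). [folklore] -/
theorem continuous_angCoeff {g : ℝ² → ℂ} (hg : Continuous g) (n : ℤ) :
    Continuous fun r => angCoeff g r n := by
  unfold angCoeff
  refine continuous_const.mul ?_
  exact intervalIntegral.continuous_parametric_intervalIntegral_of_continuous'
    (f := fun r θ => angExp (-n) θ * g (circlePt r θ))
    (((continuous_angExp (-n)).comp continuous_snd).mul (hg.comp continuous_circlePt_uncurry)) _ _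

/-- **Radial integrability of the coefficients**: for a continuous integrable `g`,
`ρ ↦ ρ ‖ĝ_n(ρ)‖` is integrable on `(0, ∞)` (it is dominated by the radial marginal
`(2π)⁻¹ ∫ ‖ρ • g(circlePt ρ θ)‖ dθ` of `‖g‖` in polar coordinates). [folklore] -/
theorem integrableOn_mul_norm_angCoeff {g : ℝ² → ℂ} (hg : Continuous g) (hgi : Integrable g)
    (n : ℤ) : IntegrableOn (fun ρ : ℝ => ρ * ‖angCoeff g ρ n‖) (Ioi 0) := by
  have hπ : -π ≤ π := by linarith [Real.pi_pos]
  have hmaj := (integrableOn_integral_norm_circlePt_smul hgi).const_mul (2 * π)⁻¹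
  refine Integrable.mono' hmaj
    (continuous_id.mul (continuous_angCoeff hg n).norm).aestronglyMeasurable ?_
  refine (ae_restrict_iff' measurableSet_Ioi).2 (Eventually.of_forall fun ρ hρ => ?_)
  have hρ' : 0 ≤ ρ := le_of_lt hρ
  rw [Real.norm_of_nonneg (by positivity)]
  calc ρ * ‖angCoeff g ρ n‖ ≤ ρ * ((2 * π)⁻¹ * ∫ θ in (-π)..π, ‖g (circlePt ρ θ)‖) := by
        gcongr; exact norm_angCoeff_le g ρ n
    _ = (2 * π)⁻¹ * ∫ θ in Ioc (-π) π, ‖ρ • g (circlePt ρ θ)‖ := by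
        rw [intervalIntegral.integral_of_le hπ]
        simp_rw [norm_smul, Real.norm_of_nonneg hρ']
        rw [integral_const_mul]
        ring

/-- On the circle of radius `0` only the mean survives: `ŵ_n(0) = 0` for `n ≠ 0`. [folklore] -/
theorem angCoeff_zero_radius (g : ℝ² → ℂ) {n : ℤ} (hn : n ≠ 0) : angCoeff g 0 n = 0 := by
  have h := integral_angExp_neg_mul_angExp 0 n
  simp only [angExp_zero, mul_one, if_neg hn.symm] at h
  simp only [angCoeff, circlePt_zero_left]
  rw [intervalIntegral.integral_mul_const, ← mul_assoc, h, zero_mul]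

/-- **The coefficient of an angular derivative**: for a `C¹` function `f`,
`(2π)⁻¹∫ e^{-inθ} ∂_θ[f(circlePt r θ)] dθ = i n f̂_n(r)`, where
`∂_θ[f(circlePt r θ)] = Df(ξ)[ξ^⊥]` at `ξ = circlePt r θ` (integration by parts on a full turn,
no boundary terms by periodicity). [folklore] -/
theorem angCoeff_fderiv_perp {f : ℝ² → ℝ} (hf : ContDiff ℝ 1 f) (r : ℝ) (n : ℤ) :
    angCoeff (fun ξ => (fderiv ℝ f ξ (perp ξ) : ℂ)) r n =
      I * n * angCoeff (fun ξ => (f ξ : ℂ)) r n := by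
  have hπ : -π ≤ π := by linarith [Real.pi_pos]
  have hd : Differentiable ℝ f := hf.differentiable one_ne_zero
  -- `v(θ) = f(circlePt r θ)` and its derivative
  have hv : ∀ θ : ℝ, HasDerivAt (fun θ : ℝ => (f (circlePt r θ) : ℂ))
      ((fderiv ℝ f (circlePt r θ) (perp (circlePt r θ)) : ℂ)) θ := fun θ =>
    ((hd _).hasFDerivAt.comp_hasDerivAt θ (hasDerivAt_circlePt r θ)).ofReal_comp
  have hv'c : Continuous fun θ : ℝ => ((fderiv ℝ f (circlePt r θ) (perp (circlePt r θ)) : ℝ) : ℂ) :=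
    Complex.continuous_ofReal.comp
      (((hf.continuous_fderiv one_ne_zero).comp (continuous_circlePt r)).clm_apply
        (continuous_perp_circlePt r))
  have hibp := intervalIntegral.integral_mul_deriv_eq_deriv_mul (a := -π) (b := π)
    (u := angExp (-n)) (u' := fun θ => (-n : ℤ) * I * angExp (-n) θ)
    (fun θ _ => hasDerivAt_angExp (-n) θ) (fun θ _ => hv θ)
    (((continuous_const.mul (continuous_angExp (-n))).intervalIntegrable _ _))
    (hv'c.intervalIntegrable _ _)
  have hper : circlePt r π = circlePt r (-π) := by
    have h := periodic_circlePt r (-π)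
    simp only at h
    rwa [show -π + 2 * π = π by ring] at h
  have hbd : angExp (-n) π * (f (circlePt r π) : ℂ) - angExp (-n) (-π) * (f (circlePt r (-π)) : ℂ)
      = 0 := by
    rw [angExp_pi_eq_neg_pi, hper, sub_self]
  rw [angCoeff, angCoeff, hibp, hbd, zero_sub]
  have : (fun θ : ℝ => ((-n : ℤ) : ℂ) * I * angExp (-n) θ * (f (circlePt r θ) : ℂ)) =
      fun θ => (-(n * I)) * (angExp (-n) θ * (f (circlePt r θ) : ℂ)) := by
    funext θ; push_cast; ring
  rw [this, intervalIntegral.integral_const_mul]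
  ring

/-- Mathlib's character `fourier (-n)` on `AddCircle (2π)` is `e_{-n}`. [folklore] -/
theorem fourier_neg_coe_two_pi [Fact (0 < 2 * π)] (n : ℤ) (x : ℝ) :
    fourier (-n) (x : AddCircle (2 * π)) = angExp (-n) x := by
  rw [fourier_coe_apply, angExp]
  congr 1
  have hπ : (π : ℂ) ≠ 0 := by exact_mod_cast Real.pi_pos.ne'
  push_cast
  field_simp

/-- **Fourier synthesis on a circle carrying only the modes `0, ±1`.** If `g` is continuous and
all its angular coefficients of order `|n| ≥ 2` vanish on the circle of radius `r`, then on that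
circle `g = ĝ₀ + ĝ₁ e^{iθ} + ĝ₋₁ e^{-iθ}` pointwise (uniform convergence of Fourier series with
summable coefficients, `has_pointwise_sum_fourier_series_of_summable`). [folklore] -/
theorem eq_angCoeff_sum_of_vanishing {g : ℝ² → ℂ} (hg : Continuous g) (r : ℝ)
    (h : ∀ n : ℤ, 2 ≤ |n| → angCoeff g r n = 0) (θ : ℝ) :
    g (circlePt r θ) =
      angCoeff g r 0 + angCoeff g r 1 * angExp 1 θ + angCoeff g r (-1) * angExp (-1) θ := by
  haveI : Fact (0 < 2 * π) := ⟨Real.two_pi_pos⟩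
  have hp : Periodic (fun θ : ℝ => g (circlePt r θ)) (2 * π) := fun x => by
    simp only [periodic_circlePt r x]
  have hc : Continuous fun θ : ℝ => g (circlePt r θ) := hg.comp (continuous_circlePt r)
  set F : C(AddCircle (2 * π), ℂ) := ⟨hp.lift, continuous_coinduced_dom.mpr hc⟩ with hF
  have hFx : ∀ x : ℝ, F (x : AddCircle (2 * π)) = g (circlePt r x) := fun x => rfl
  have hcoeff : ∀ n : ℤ, fourierCoeff F n = angCoeff g r n := by
    intro n
    rw [fourierCoeff_eq_intervalIntegral F n (-π), angCoeff, show -π + 2 * π = π by ring,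
      Complex.real_smul]
    congr 1
    · push_cast; ring
    · refine intervalIntegral.integral_congr fun x _ => ?_
      simp only [hFx, fourier_neg_coe_two_pi, smul_eq_mul]
  have hzero : ∀ n ∉ ({-1, 0, 1} : Finset ℤ), fourierCoeff F n = 0 := by
    intro n hn
    rw [hcoeff]
    apply h
    simp only [Finset.mem_insert, Finset.mem_singleton, not_or] at hn
    rcases le_or_gt 0 n with h0 | h0
    · rw [abs_of_nonneg h0]; omega
    · rw [abs_of_neg h0]; omega
  have hsum : Summable (fourierCoeff F) := summable_of_ne_finset_zero hzero
  have h1 := has_pointwise_sum_fourier_series_of_summable hsum (θ : AddCircle (2 * π))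
  have h2 : HasSum (fun i => fourierCoeff F i • fourier i (θ : AddCircle (2 * π)))
      (∑ i ∈ ({-1, 0, 1} : Finset ℤ), fourierCoeff F i • fourier i (θ : AddCircle (2 * π))) :=
    hasSum_sum_of_ne_finset_zero (fun n hn => by rw [hzero n hn, zero_smul])
  have h12 := h1.unique h2
  rw [hFx] at h12
  rw [h12, Finset.sum_insert (by decide), Finset.sum_insert (by decide), Finset.sum_singleton,
    hcoeff, hcoeff, hcoeff, smul_eq_mul, smul_eq_mul, smul_eq_mul,
    show (1 : ℤ) = -(-1) by ring, fourier_neg_coe_two_pi, fourier_neg_coe_two_pi]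
  simp only [neg_neg]
  rw [show (0 : ℤ) = -0 by ring, fourier_neg_coe_two_pi]
  simp only [neg_zero, angExp_zero, mul_one]
  ring

end Literature.Analysis.FluidPDE
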